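import Mathlib
import HarnessLib

/-!
# Zhang (2022), §5, Lemma 5.9 (proof): the zero-sum estimate behind
# "`L(s+β₁,ψ)/L(s,ψ) ≪ log P`" — the three displays, in integrated (signed) form, kernel-checked

Topic `Literature/NumberTheory/LFunctions/Zhang2022` (Landau–Siegel autopsy tree; verdict-neutral).
Y. Zhang, *Discrete mean estimates and the Landau–Siegel zero*, arXiv:2211.02515v1 (2022) — **an
unrefereed manuscript, a claimed result under adjudication** (cell pub-zhang: audit + repair census
of arXiv:2211.02515; no claim about Landau–Siegel) — §5 p. 11, Lemma 5.9 and its proof: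

> Lemma 5.9. Suppose `ψ ∈ Ψ₁`, `|σ − 1/2| ≤ α`, `|t − 2πt₀| ≤ 𝓛₁ + 10` and `|s − ρ| ≫ α` for any zero
> `ρ` of `L(s,ψ)`. Then `L(s+β₁,ψ)/L(s,ψ) ≪ log P`.
> Proof. It is known that `L′/L(s′,ψ) = Σ_{|ρ−s′|<1} 1/(s′−ρ) + O(1/α)` (5.16) […]. We can assume
> `L(s+β₁,ψ) ≠ 0`. Suppose `σ ≥ 1/2`. By (5.16), `−Re{L′/L(u+it+β₁,ψ)} < O(1/α)` for
> `σ < u < 1/2+α`, so that `log(|L(s+β₁,ψ)|/|L(1/2+α+it+β₁,ψ)|) < O(1)`. By (9.1) and the condition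
> `|s−ρ| ≫ α` for any `ρ`, `Re{L′/L(u+it,ψ)} = O(1/α)` for `σ < u < 1/2+α`, so that
> `log(|L(1/2+α+it,ψ)|/|L(s,ψ)|) < O(1)`. Further, by (5.16) and Proposition 2.2 (iii),
> `|L′/L(1/2+α+it′,ψ)| < (1/α)Σ_{k<1/α} 1/k + O(1/α) < (log log P)/α + O(1/α)` for
> `t < t′ < t+|β₁|`, so that `log(|L(1/2+α+it+β₁,ψ)|/|L(1/2+α+it,ψ)|) < log log P + O(1)`.
> Combining these estimates we obtain the result. In the case `σ < 1/2` the proof is analogous.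

Here `β₁ = iv₁`, `v₁ = α(1 − 5c′α𝓛) > 0` ((2.13)), the zeros `ρ = 1/2 + iγ` near `s` lie on the
critical line, are simple, and consecutive ordinates differ by `α + O(c′α²𝓛)` (Proposition 2.2).
Integrating the partial fraction (5.16) along a path from `s` to `s + β₁`, the three displays
bound the MAIN TERM `Σ_ρ (log|s+β₁−ρ| − log|s−ρ|)` — the exact integral of `Re Σ_ρ 1/(s′−ρ) ds′` —
by `log log P + O(1)`, the `O(1/α)` remainders contributing `O(1)` over a path of length `O(α)`.
(The typed reading of the cell — STEPS row L5.9 — records that the third display is a bound on the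
MODULUS obtained from a SIGNED count: zeros above and below `t′` enter `Im Σ 1/(s′−ρ)` with opposite
signs. In the integrated form below this is the observation that zeros with ordinate `γ ≥ t + v₁/2`
contribute NON-POSITIVELY.)

This file PROVES that main-term estimate as a statement about finitely many real numbers (the
differences `d = t − γ` over the zeros), with every constant explicit and the manuscript's parameters
free: for `g > 0` (the minimal gap), `r > 0` (the distance `|s − ρ| ≥ r`), `v ≥ 0` (the shift),
`|a| ≤ α` (`a = σ − 1/2`), `r ≤ R₀` (the window `|d| ≤ R₀`), and a `g`-separated finite set `D` of
reals `d` with `|d| ≤ R₀`, `r² ≤ a² + d²`, `0 < a² + (d+v)²`: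

* `Lemma59.sum_logRatio_le` —
  `Σ_{d∈D} ½(log(a²+(d+v)²) − log(a²+d²))`
  `  ≤ ((r+v/2)/g + 1)·½log((α²+(r+v)²)/r²) + v/r + (v/g)·log(R₀/r) + (v²/2)(1/r² + 1/(gr))`.
  With the manuscript's `r = α` (on `𝔍(±α)`), `v = v₁ ≤ g ≤ α`... the right side is
  `log(1/α) + O(1) = log log P + O(1)`, i.e. `|L(s+β₁)/L(s)| ≪ log P` once the `O(1/α)`-remainder of
  (5.16) is integrated over the path of length `v₁ ≤ α` (that analytic step is NOT in this file).

The ingredients, all proved here: zeros with `d ≤ −v/2` contribute `≤ 0` (`logRatio_nonpos`, the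
sign behind displays 1 and 3); the `≤ (r+v/2)/g + 1` zeros with `−v/2 < d < r` contribute
`≤ ½log((α²+(r+v)²)/r²)` each (`logRatio_le_near`, `card_le_of_separated`); the zeros with `d ≥ r`
contribute `≤ v/d + v²/(2d²)` each (`logRatio_le_far`, from `log x ≤ x − 1`), and over a
`g`-separated set these sum to `≤ v/r + (v/g)log(R₀/r) + (v²/2)(1/r² + 1/(gr))`
(`sum_le_sum_range_of_separated` — a `g`-separated set in `[r, ∞)` dominates the arithmetic
progression `r + kg` — and the telescoping bounds `sum_range_inv_le`, `sum_range_inv_sq_le`; this is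
the manuscript's "`(1/α)Σ_{k<1/α} 1/k`", with `Σ 1/k` replaced by the integral of `1/x`).

Nothing about Theorems 1–2 of the source is stated or implied; nothing here bears on the cell's
verdict on (8.24).

## References

* Y. Zhang, arXiv:2211.02515v1 (2022), §5 p. 11, Lemma 5.9 (proof: (5.16) and the three displays);
  (2.13); Proposition 2.2. [cite: Zhang2022LandauSiegel, §5 Lemma 5.9 (proof)]
-/

noncomputable section

open Real Finset

namespace Literature.NumberTheory.LFunctions.Zhang2022

namespace Lemma59

/-! ### `g`-separated finite sets of reals -/

/-- A finite set of reals is `g`-separated when distinct elements differ by at least `g` (the gap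
assertion of Proposition 2.2 (iii) for the ordinates of the zeros).
[cite: Zhang2022LandauSiegel, §2 Proposition 2.2 (iii)] -/
def Separated (g : ℝ) (D : Finset ℝ) : Prop := ∀ x ∈ D, ∀ y ∈ D, x ≠ y → g ≤ |x - y|

/-- Unfolding lemma for `Separated`. [cite: Zhang2022LandauSiegel, §2 Proposition 2.2 (iii)] -/
lemma separated_def (g : ℝ) (D : Finset ℝ) :
    Separated g D ↔ ∀ x ∈ D, ∀ y ∈ D, x ≠ y → g ≤ |x - y| := Iff.rfl

/-- Subsets of a `g`-separated set are `g`-separated. [folklore] -/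
private lemma Separated.mono {g : ℝ} {D D' : Finset ℝ} (h : Separated g D) (hsub : D' ⊆ D) :
    Separated g D' :=
  fun x hx y hy hxy => h x (hsub hx) y (hsub hy) hxy

/-- **A `g`-separated set in `[r, ∞)` dominates the progression `r, r+g, r+2g, …`**: if `D` is
`g`-separated (`g > 0`) with all elements `≥ r`, then some element is `≥ r + (|D|−1)g`, and for `f`
antitone on `[r, ∞)`, `Σ_{x∈D} f(x) ≤ Σ_{k<|D|} f(r + kg)` (the comparison behind the manuscript's
"`Σ_{k<1/α} 1/k`" with gaps `≈ α`). [cite: Zhang2022LandauSiegel, §5 Lemma 5.9 (proof, third display)] -/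
theorem sum_le_sum_range_of_separated {g r : ℝ} (hg : 0 < g) {f : ℝ → ℝ}
    (hf : AntitoneOn f (Set.Ici r)) (D : Finset ℝ) (hsep : Separated g D) (hr : ∀ x ∈ D, r ≤ x) :
    (D.Nonempty → ∃ x ∈ D, r + ((D.card : ℝ) - 1) * g ≤ x) ∧
      ∑ x ∈ D, f x ≤ ∑ i ∈ Finset.range D.card, f (r + i * g) := by
  induction D using Finset.induction_on_max with
  | empty => simp
  | insert a s ha ih =>
    have hsep_s : Separated g s := hsep.mono (subset_insert _ _)
    have hr_s : ∀ x ∈ s, r ≤ x := fun x hx => hr x (mem_insert_of_mem hx)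
    obtain ⟨ih1, ih2⟩ := ih hsep_s hr_s
    have has : a ∉ s := fun h => lt_irrefl a (ha a h)
    have hcard : (insert a s).card = s.card + 1 := card_insert_of_notMem has
    have hra : r ≤ a := hr a (mem_insert_self _ _)
    -- the new maximum lies at least `g` above the old one
    have ha_ge : r + (s.card : ℝ) * g ≤ a := by
      rcases s.eq_empty_or_nonempty with hs | hs
      · simp [hs, hra]
      · obtain ⟨x, hx, hxge⟩ := ih1 hs
        have hax : g ≤ |a - x| :=
          hsep a (mem_insert_self _ _) x (mem_insert_of_mem hx) (ne_of_gt (ha x hx))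
        rw [abs_of_pos (sub_pos.2 (ha x hx))] at hax
        linarith
    refine ⟨fun _ => ⟨a, mem_insert_self _ _, ?_⟩, ?_⟩
    · rw [hcard]; push_cast; linarith
    · rw [sum_insert has, hcard, sum_range_succ]
      have hmem : r + (s.card : ℝ) * g ∈ Set.Ici r := by
        simp only [Set.mem_Ici, le_add_iff_nonneg_right]; positivity
      have hfa : f a ≤ f (r + (s.card : ℝ) * g) := hf hmem (Set.mem_Ici.2 hra) ha_ge
      linarith

/-- **Counting**: a `g`-separated set (`g > 0`) contained in `[lo, hi)` has at most
`(hi − lo)/g + 1` elements. [cite: Zhang2022LandauSiegel, §5 Lemma 5.9 (proof)] -/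
theorem card_le_of_separated {g lo hi : ℝ} (hg : 0 < g) (hlohi : lo ≤ hi) (D : Finset ℝ)
    (hsep : Separated g D) (hlo : ∀ x ∈ D, lo ≤ x) (hhi : ∀ x ∈ D, x < hi) :
    (D.card : ℝ) ≤ (hi - lo) / g + 1 := by
  rcases D.eq_empty_or_nonempty with hD | hD
  · rw [hD, card_empty, Nat.cast_zero]
    have : 0 ≤ (hi - lo) / g := div_nonneg (sub_nonneg.2 hlohi) hg.le
    linarith
  · obtain ⟨x, hx, hxge⟩ :=
      (sum_le_sum_range_of_separated hg (antitoneOn_const (c := (0 : ℝ))) D hsep hlo).1 hD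
    have hxhi := hhi x hx
    have h1 : ((D.card : ℝ) - 1) * g ≤ hi - lo := by linarith
    have h2 : (D.card : ℝ) - 1 ≤ (hi - lo) / g := by rw [le_div_iff₀ hg]; exact h1
    linarith

/-! ### Telescoping bounds for the progression sums -/

/-- `Σ_{k ≤ K} 1/(r + kg) ≤ 1/r + (1/g)·log((r + Kg)/r)` (`r, g > 0`): each term after the first is
at most the integral of `1/x` over the preceding gap (`1 − 1/x ≤ log x`). [folklore] -/
private lemma sum_range_inv_le {g r : ℝ} (hg : 0 < g) (hr : 0 < r) (K : ℕ) :
    ∑ i ∈ Finset.range (K + 1), 1 / (r + i * g) ≤ 1 / r + 1 / g * Real.log ((r + K * g) / r) := by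
  induction K with
  | zero => simp
  | succ K ih =>
    rw [sum_range_succ]
    have hK0 : 0 < r + K * g := by positivity
    have hK1 : 0 < r + (K + 1 : ℕ) * g := by positivity
    -- the new term is bounded by the increment of the logarithm
    have hstep : 1 / (r + (K + 1 : ℕ) * g)
        ≤ 1 / g * (Real.log ((r + (K + 1 : ℕ) * g) / r) - Real.log ((r + K * g) / r)) := by
      rw [← Real.log_div (by positivity) (by positivity), div_div_div_cancel_right₀ hr.ne']
      have h := Real.one_sub_inv_le_log_of_pos (div_pos hK1 hK0)
      rw [inv_div] at h
      have e : 1 - (r + K * g) / (r + (K + 1 : ℕ) * g) = g / (r + (K + 1 : ℕ) * g) := by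
        field_simp
        push_cast
        ring
      rw [e] at h
      calc 1 / (r + (K + 1 : ℕ) * g) = 1 / g * (g / (r + (K + 1 : ℕ) * g)) := by
            field_simp
        _ ≤ _ := by gcongr
    calc ∑ i ∈ Finset.range (K + 1), 1 / (r + i * g) + 1 / (r + (K + 1 : ℕ) * g)
        ≤ (1 / r + 1 / g * Real.log ((r + K * g) / r))
          + 1 / g * (Real.log ((r + (K + 1 : ℕ) * g) / r) - Real.log ((r + K * g) / r)) :=
          add_le_add ih hstep
      _ = 1 / r + 1 / g * Real.log ((r + (K + 1 : ℕ) * g) / r) := by ring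

/-- `Σ_{k ≤ K} 1/(r + kg)² ≤ 1/r² + 1/(gr)` (`r, g > 0`): the terms after the first telescope against
`1/(r+(k−1)g) − 1/(r+kg)`. [folklore] -/
private lemma sum_range_inv_sq_le {g r : ℝ} (hg : 0 < g) (hr : 0 < r) (K : ℕ) :
    ∑ i ∈ Finset.range (K + 1), 1 / (r + i * g) ^ 2 ≤ 1 / r ^ 2 + 1 / (g * r) := by
  -- sharper telescoped form
  have key : ∑ i ∈ Finset.range (K + 1), 1 / (r + i * g) ^ 2
      ≤ 1 / r ^ 2 + 1 / g * (1 / r - 1 / (r + K * g)) := by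
    induction K with
    | zero => simp
    | succ K ih =>
      rw [sum_range_succ]
      have hK0 : 0 < r + K * g := by positivity
      have hK1 : 0 < r + (K + 1 : ℕ) * g := by positivity
      have hle : r + K * g ≤ r + (K + 1 : ℕ) * g := by push_cast; nlinarith
      have hstep : 1 / (r + (K + 1 : ℕ) * g) ^ 2
          ≤ 1 / g * (1 / (r + K * g) - 1 / (r + (K + 1 : ℕ) * g)) := by
        have e : 1 / g * (1 / (r + K * g) - 1 / (r + (K + 1 : ℕ) * g))
            = 1 / ((r + K * g) * (r + (K + 1 : ℕ) * g)) := by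
          field_simp
          push_cast
          ring
        rw [e, sq]
        exact one_div_le_one_div_of_le (by positivity) (by gcongr)
      calc ∑ i ∈ Finset.range (K + 1), 1 / (r + i * g) ^ 2 + 1 / (r + (K + 1 : ℕ) * g) ^ 2
          ≤ (1 / r ^ 2 + 1 / g * (1 / r - 1 / (r + K * g)))
            + 1 / g * (1 / (r + K * g) - 1 / (r + (K + 1 : ℕ) * g)) := add_le_add ih hstep
        _ = 1 / r ^ 2 + 1 / g * (1 / r - 1 / (r + (K + 1 : ℕ) * g)) := by ring
  refine key.trans ?_
  have hK0 : 0 < r + K * g := by positivity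
  have : 0 ≤ 1 / g * (1 / (r + K * g)) := by positivity
  have e : 1 / (g * r) = 1 / g * (1 / r) := by rw [one_div_mul_one_div]
  rw [e]
  nlinarith

/-! ### The three zones of zeros -/

/-- The summand: `log|s + iv − ρ| − log|s − ρ| = ½(log(a² + (d+v)²) − log(a² + d²))` for
`ρ = 1/2 + iγ`, `a = σ − 1/2`, `d = t − γ`. [cite: Zhang2022LandauSiegel, §5 Lemma 5.9 (proof)] -/
def logRatio (a v d : ℝ) : ℝ := 1 / 2 * (Real.log (a ^ 2 + (d + v) ^ 2) - Real.log (a ^ 2 + d ^ 2))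

/-- Unfolding lemma for `logRatio`. [cite: Zhang2022LandauSiegel, §5 Lemma 5.9 (proof)] -/
lemma logRatio_def (a v d : ℝ) :
    logRatio a v d = 1 / 2 * (Real.log (a ^ 2 + (d + v) ^ 2) - Real.log (a ^ 2 + d ^ 2)) := rfl

/-- **Zeros above `t + v/2` contribute non-positively** (`d = t − γ ≤ −v/2`, `v ≥ 0`): the sign
behind the first and third displays. [cite: Zhang2022LandauSiegel, §5 Lemma 5.9 (proof)] -/
theorem logRatio_nonpos {a v d : ℝ} (hv : 0 ≤ v) (hd : d ≤ -(v / 2))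
    (hpos : 0 < a ^ 2 + (d + v) ^ 2) : logRatio a v d ≤ 0 := by
  rw [logRatio_def]
  have hle : a ^ 2 + (d + v) ^ 2 ≤ a ^ 2 + d ^ 2 := by nlinarith
  have := Real.log_le_log hpos hle
  linarith

/-- **The near zeros** (`−v/2 < d < r`, with `|s − ρ| ≥ r`, i.e. `r² ≤ a² + d²`, and `|a| ≤ α`):
each contributes at most `½log((α² + (r+v)²)/r²)`. [cite: Zhang2022LandauSiegel, §5 Lemma 5.9 (proof)] -/
theorem logRatio_le_near {a v d r α : ℝ} (hv : 0 ≤ v) (hr : 0 < r) (ha : |a| ≤ α)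
    (hd1 : -(v / 2) < d) (hd2 : d < r) (hdist : r ^ 2 ≤ a ^ 2 + d ^ 2) :
    logRatio a v d ≤ 1 / 2 * Real.log ((α ^ 2 + (r + v) ^ 2) / r ^ 2) := by
  rw [logRatio_def, Real.log_div (by positivity) (by positivity)]
  have hdv : 0 < d + v := by linarith
  have hpos : 0 < a ^ 2 + (d + v) ^ 2 := by positivity
  have ha2 : a ^ 2 ≤ α ^ 2 := by
    rw [← sq_abs a]
    exact pow_le_pow_left₀ (abs_nonneg a) ha 2
  have hnum : a ^ 2 + (d + v) ^ 2 ≤ α ^ 2 + (r + v) ^ 2 := by nlinarith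
  have h1 := Real.log_le_log hpos hnum
  have h2 := Real.log_le_log (by positivity) hdist
  linarith

/-- **The far zeros below** (`d ≥ r > 0`): `½log((a²+(d+v)²)/(a²+d²)) ≤ v/d + v²/(2d²)`
(`log x ≤ x − 1`). [cite: Zhang2022LandauSiegel, §5 Lemma 5.9 (proof)] -/
theorem logRatio_le_far {a v d r : ℝ} (hv : 0 ≤ v) (hr : 0 < r) (hd : r ≤ d) :
    logRatio a v d ≤ v / d + v ^ 2 / (2 * d ^ 2) := by
  have hd0 : 0 < d := lt_of_lt_of_le hr hd
  have hden : 0 < a ^ 2 + d ^ 2 := by positivity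
  have hnum : 0 < a ^ 2 + (d + v) ^ 2 := by positivity
  rw [logRatio_def, ← Real.log_div hnum.ne' hden.ne']
  have h1 := Real.log_le_sub_one_of_pos (div_pos hnum hden)
  have h2 : (a ^ 2 + (d + v) ^ 2) / (a ^ 2 + d ^ 2) - 1 = (2 * d * v + v ^ 2) / (a ^ 2 + d ^ 2) := by
    rw [div_sub_one hden.ne']
    congr 1
    ring
  have h3 : (2 * d * v + v ^ 2) / (a ^ 2 + d ^ 2) ≤ (2 * d * v + v ^ 2) / d ^ 2 :=
    div_le_div_of_nonneg_left (by positivity) (by positivity) (by nlinarith)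
  have h4 : (2 * d * v + v ^ 2) / d ^ 2 = 2 * (v / d + v ^ 2 / (2 * d ^ 2)) := by
    field_simp
  linarith

/-- `x ↦ v/x + v²/(2x²)` is antitone on `[r, ∞)` (`r > 0`, `v ≥ 0`). [folklore] -/
private lemma antitoneOn_far (v r : ℝ) (hv : 0 ≤ v) (hr : 0 < r) :
    AntitoneOn (fun x : ℝ => v / x + v ^ 2 / (2 * x ^ 2)) (Set.Ici r) := by
  intro x hx y hy hxy
  have hx0 : 0 < x := lt_of_lt_of_le hr hx
  have hy0 : 0 < y := lt_of_lt_of_le hr hy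
  simp only
  gcongr

/-! ### The estimate -/

/-- **The zero sum of Lemma 5.9's proof, bounded** (the three displays in integrated form): for
`g > 0`, `0 < r ≤ R₀`, `v ≥ 0`, `|a| ≤ α`, and a `g`-separated finite set `D` of reals with
`|d| ≤ R₀`, `r² ≤ a² + d²` and `0 < a² + (d+v)²` for every `d ∈ D`,
`Σ_{d∈D} ½(log(a²+(d+v)²) − log(a²+d²))`
`  ≤ ((r+v/2)/g + 1)·½log((α²+(r+v)²)/r²) + (v/r + (v/g)log(R₀/r)) + (v²/2)(1/r² + 1/(gr))`.
(Zones: `d ≤ −v/2` contributes `≤ 0`; `−v/2 < d < r`, at most `(r+v/2)/g + 1` zeros, each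
`≤ ½log((α²+(r+v)²)/r²)`; `d ≥ r`, dominated by the progression `r + kg`.) With the manuscript's
`r = α`, `v = v₁ ≤ g ≈ α`, `R₀ ≍ 1`, the right side is `log(1/α) + O(1) = log log P + O(1)`.
[cite: Zhang2022LandauSiegel, §5 Lemma 5.9 (proof)] -/
theorem sum_logRatio_le {g r R₀ v a α : ℝ} (hg : 0 < g) (hr : 0 < r) (hrR : r ≤ R₀) (hv : 0 ≤ v)
    (ha : |a| ≤ α) (D : Finset ℝ) (hsep : Separated g D)
    (hD : ∀ d ∈ D, |d| ≤ R₀ ∧ r ^ 2 ≤ a ^ 2 + d ^ 2 ∧ 0 < a ^ 2 + (d + v) ^ 2) :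
    ∑ d ∈ D, logRatio a v d
      ≤ ((r + v / 2) / g + 1) * (1 / 2 * Real.log ((α ^ 2 + (r + v) ^ 2) / r ^ 2))
        + (v / r + v / g * Real.log (R₀ / r)) + v ^ 2 / 2 * (1 / r ^ 2 + 1 / (g * r)) := by
  classical
  -- the three zones
  set A := D.filter (fun d => d ≤ -(v / 2)) with hA
  set B := D.filter (fun d => -(v / 2) < d ∧ d < r) with hB
  set C := D.filter (fun d => r ≤ d) with hC
  have hsplit : ∑ d ∈ D, logRatio a v d
      = ∑ d ∈ A, logRatio a v d + (∑ d ∈ B, logRatio a v d + ∑ d ∈ C, logRatio a v d) := by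
    have h1 := (sum_filter_add_sum_filter_not D (fun d => d ≤ -(v / 2))
      (fun d => logRatio a v d)).symm
    have h2 := (sum_filter_add_sum_filter_not (D.filter fun d => ¬ d ≤ -(v / 2)) (fun d => d < r)
      (fun d => logRatio a v d)).symm
    rw [filter_filter, filter_filter] at h2
    have hB' : (D.filter fun d => ¬ d ≤ -(v / 2) ∧ d < r) = B := by
      rw [hB]; ext d; simp only [mem_filter, not_le]
    have hC' : (D.filter fun d => ¬ d ≤ -(v / 2) ∧ ¬ d < r) = C := by
      rw [hC]; ext d; simp only [mem_filter, not_le, not_lt]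
      constructor
      · rintro ⟨h1, -, h3⟩; exact ⟨h1, h3⟩
      · rintro ⟨h1, h3⟩; exact ⟨h1, by linarith, h3⟩
    rw [hB', hC'] at h2
    rw [h1, h2]
  -- zone A: non-positive
  have hAle : ∑ d ∈ A, logRatio a v d ≤ 0 := by
    refine sum_nonpos fun d hd => ?_
    rw [hA, mem_filter] at hd
    exact logRatio_nonpos hv hd.2 (hD d hd.1).2.2
  -- zone B: bounded count, bounded terms
  set T₀ : ℝ := 1 / 2 * Real.log ((α ^ 2 + (r + v) ^ 2) / r ^ 2) with hT₀
  have hT₀0 : 0 ≤ T₀ := by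
    rw [hT₀]
    refine mul_nonneg (by norm_num) (Real.log_nonneg ?_)
    rw [le_div_iff₀ (by positivity)]
    have : 0 ≤ α := (abs_nonneg a).trans ha
    nlinarith
  have hBsep : Separated g B := hsep.mono (filter_subset _ _)
  have hBcard : (B.card : ℝ) ≤ (r - -(v / 2)) / g + 1 :=
    card_le_of_separated hg (by linarith) B hBsep
      (fun x hx => by rw [hB, mem_filter] at hx; exact hx.2.1.le)
      (fun x hx => by rw [hB, mem_filter] at hx; exact hx.2.2)
  have hBle : ∑ d ∈ B, logRatio a v d ≤ ((r + v / 2) / g + 1) * T₀ := by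
    calc ∑ d ∈ B, logRatio a v d ≤ ∑ _d ∈ B, T₀ := by
          refine sum_le_sum fun d hd => ?_
          rw [hB, mem_filter] at hd
          exact logRatio_le_near hv hr ha hd.2.1 hd.2.2 (hD d hd.1).2.1
      _ = B.card * T₀ := by rw [sum_const, nsmul_eq_mul]
      _ ≤ ((r + v / 2) / g + 1) * T₀ := by
          have : (r - -(v / 2)) = r + v / 2 := by ring
          rw [this] at hBcard
          exact mul_le_mul_of_nonneg_right hBcard hT₀0
  -- zone C: dominated by the progression `r + kg`
  have hCsep : Separated g C := hsep.mono (filter_subset _ _)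
  have hCr : ∀ x ∈ C, r ≤ x := fun x hx => by rw [hC, mem_filter] at hx; exact hx.2
  have hCle : ∑ d ∈ C, logRatio a v d
      ≤ (v / r + v / g * Real.log (R₀ / r)) + v ^ 2 / 2 * (1 / r ^ 2 + 1 / (g * r)) := by
    have h1 : ∑ d ∈ C, logRatio a v d ≤ ∑ d ∈ C, (v / d + v ^ 2 / (2 * d ^ 2)) :=
      sum_le_sum fun d hd => logRatio_le_far hv hr (hCr d hd)
    obtain ⟨hmax, h2⟩ := sum_le_sum_range_of_separated hg (antitoneOn_far v r hv hr) C hCsep hCr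
    refine h1.trans (h2.trans ?_)
    rcases Nat.eq_zero_or_pos C.card with h0 | hpos
    · rw [h0, sum_range_zero]
      have : 0 ≤ Real.log (R₀ / r) := Real.log_nonneg (by rw [le_div_iff₀ hr]; linarith)
      positivity
    · obtain ⟨K, hK⟩ : ∃ K, C.card = K + 1 := ⟨C.card - 1, by omega⟩
      rw [hK, sum_add_distrib]
      -- the maximal element shows `r + Kg ≤ R₀`
      have hKR : r + K * g ≤ R₀ := by
        have hne : C.Nonempty := card_pos.1 hpos
        obtain ⟨x, hx, hxge⟩ := hmax hne
        rw [hK] at hxge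
        push_cast at hxge
        have hxR : x ≤ R₀ := by
          have hxD : x ∈ D := by
            rw [hC] at hx
            exact (mem_filter.1 hx).1
          exact (le_abs_self x).trans (hD x hxD).1
        linarith
      have hs1 : ∑ i ∈ Finset.range (K + 1), v / (r + i * g)
          ≤ v / r + v / g * Real.log (R₀ / r) := by
        have e : ∀ i : ℕ, v / (r + i * g) = v * (1 / (r + i * g)) := fun i => by
          rw [mul_one_div]
        simp_rw [e]
        rw [← mul_sum]
        have hlog : Real.log ((r + K * g) / r) ≤ Real.log (R₀ / r) :=
          Real.log_le_log (by positivity) (by gcongr)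
        calc v * ∑ i ∈ Finset.range (K + 1), 1 / (r + i * g)
            ≤ v * (1 / r + 1 / g * Real.log ((r + K * g) / r)) :=
              mul_le_mul_of_nonneg_left (sum_range_inv_le hg hr K) hv
          _ ≤ v * (1 / r + 1 / g * Real.log (R₀ / r)) := by gcongr
          _ = v / r + v / g * Real.log (R₀ / r) := by ring
      have hs2 : ∑ i ∈ Finset.range (K + 1), v ^ 2 / (2 * (r + i * g) ^ 2)
          ≤ v ^ 2 / 2 * (1 / r ^ 2 + 1 / (g * r)) := by
        have e : ∀ i : ℕ, v ^ 2 / (2 * (r + i * g) ^ 2) = v ^ 2 / 2 * (1 / (r + i * g) ^ 2) :=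
          fun i => by rw [mul_one_div, div_div]
        simp_rw [e]
        rw [← mul_sum]
        exact mul_le_mul_of_nonneg_left (sum_range_inv_sq_le hg hr K) (by positivity)
      exact add_le_add hs1 hs2
  rw [hsplit]
  linarith

end Lemma59

end Literature.NumberTheory.LFunctions.Zhang2022
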